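import Summits.BirchSwinnertonDyer.BirchSwinnertonDyer.Theorems.SchneiderFreeAdditiveX3ControlGlobalPTorsionF
import Summits.BirchSwinnertonDyer.BirchSwinnertonDyer.Theorems.SchneiderFreeAdditiveX3StepLManinLinkOfKolyvagin
import Summits.BirchSwinnertonDyer.BirchSwinnertonDyer.Theorems.SchneiderFreeAdditiveX3HeegnerTwistData
import Summits.BirchSwinnertonDyer.BirchSwinnertonDyer.Theorems.SchneiderFreeAdditiveX3JointLowerManin
import Summits.BirchSwinnertonDyer.BirchSwinnertonDyer.Theorems.SchneiderFreeAdditiveX3PartnerUpperRankZero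
import Summits.BirchSwinnertonDyer.Rank1Residual.X11b.BDPRouteNonsingularTorsionDivisible
import Summits.BirchSwinnertonDyer.Rank1Residual.X11b.BDPRouteLocalKernelAtPPadic
import Summits.BirchSwinnertonDyer.Rank1Residual.X11b.AnticyclotomicEulerChar
import HarnessLib

/-!
# Route `SchneiderFreeAdditiveX3` (rung K1 door): the control corner in INEQUALITY form needs no Fin_v —
# the rung leaf from `PrintedFacts`, `ControlFacts` and the two branch main conjectures alone

Seat `bsd-schneider-door-c4`, gen 4 (cell `bsd-schneider-ideate`); crux chain 18969 → 19295 → 19548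
`AnticycControlAdditiveKF` (the SERVED control corner, skeleton v4-KF: regimes A / B1 / B2 CLOSED, the one
open input being crux r5 `LocalTowerTorsionFiniteX3` = Fin_v at the `(3, e = 2)` local-`3`-torsion frames).

OBSERVATION (kernel-checked here). The target `StepLManin` consumes the control corner only through
`index_le_slack_of_additive_links`, i.e. only through the INEQUALITY
`ord_p f(0) ≤ ord_p #Ш(E/K)[p^∞] + 2(ord_p log_ω P − ord_p[E(K):ℤP]) + ord_p ∏_{w∣N⁺} c_w(E/K)` (the cell's
predicate `SchneiderFreeControlAtoms.AdditiveControlLeOnTreeAt … 0 P`), NOT the typed EQUALITY. In door-c4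
gen 0's count `#Sel^γ · #ker res = #Sel_𝔭(K) · #ker r_𝔭 · ∏_{Σ(N⁺)} #ker r_w` Fin_v enters ONLY through
`#ker r_𝔭 = p^{t_p}`, while the tree has UNCONDITIONALLY (any `ℤ_p`-extension, no Brink, no Fin_v)
`#ker r_𝔭 ≤ #E(ℚ_p)[p^∞] = p^{t_p}` (X11b `natCard_localKer_le_natCard_primaryComponent_padic`) and
`#ker r_w ≤ c_w^{(p)}` (`natCard_localKer_le_pow_padicValNat_localTamagawaNumber`). With door-c4 gen 3's base
count `#Sel_𝔭(K)·#E(ℚ_p)[p^∞] = p^a` the `−t_p` is repaid by `≤ + t_p`, so the INEQUALITY holds at EVERY frame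
(any `g`, any `t_p`, both cells) from Poitou–Tate duality, the duality for `Ш`, and Kolyvagin ALONE.

* §1 `additiveControlLeOnTreeAt_of_torsAtomsLe` — gen 0's glue `additiveControlOnTreeAt_of_torsAtoms` with
  (KER-𝔭) weakened to `#ker r_𝔭 ≤ p^t` and (P11) replaced by the tree's unconditional `≤ c_w^{(p)}`;
  conclusion `AdditiveControlLeOnTreeAt p κ 𝔭 γ ι 0 P`.
* §2 `additiveControlLeOnTreeAt_of_facts` — the control INEQUALITY at every frame of the door from
  `poitouTate_selmerStructure_duality`, `poitouTate_sha_tateDual`, `kolyvagin` (no Brink, no Fin_v).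
* §3 `index_le_slack_of_additive_linksLe`, `indexLowerBoundLeAt_of_frames_of_shaFinite_le`,
  `stepLManin_of_facts_of_branchIMCs` — door-c2's link re-run with `≤`: the route's TARGET `StepLManin` from
  the three facts and the two branch cruxes `PotMultBranchIMC` (r2), `GordTwoBranchIMC` (r3).
* §4 `additiveX3RankOneLower_of_printedFacts_of_controlFacts_of_branchIMCs` — the route's deciding theorem
  re-run WITHOUT `h4 : AnticycControlAdditiveKF` and `hL : StepLManinLinkR`, the closed support items
  `HeegnerTwistData` / `JointLowerManin` / `PartnerUpperRankZero` discharged by their `_proof` theorems: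
  `PrintedFacts → ControlFacts → PotMultBranchIMC → GordTwoBranchIMC → SchneiderFree.AdditiveX3RankOneLower`
  (Brink's two conjuncts of `ControlFacts` are not even used: `additiveX3RankOneLower_of_facts_of_branchIMCs`).

CONSEQUENCE: cruxes r4 (19548, 19295) and r5 (19546, Fin_v) are NOT on the critical path of the leaf; the
EQUALITY they type remains the exact-count record. CONDITIONAL on the cited facts carried as antecedents;
closes no item by name; BSD is not advanced beyond the typed reduction. References: [JetchevSkinnerWan2017]
§3.2–3.3, Thm. 3.3.1, §7.4.1 (arXiv:1512.06894 pp. 10–14, 30); [GreenbergLNM1716] §3 Lemma 3.3 (p. 87), §4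
p. 74; [Castella2018] Thm. 2.3 (arXiv:1704.06608 pp. 5–6); [MilneADT2006] I 2.8, 4.10; [Kolyvagin1990] Thm. A.
-/

noncomputable section

open scoped Classical

open Field NumberField IsDedekindDomain WeierstrassCurve
open Literature.NumberTheory.EllipticCurves Literature.NumberTheory.EllipticCurves.GreenbergSelmer
open Literature.NumberTheory.GaloisRepresentations
open Literature.NumberTheory.GaloisCohomology
open Literature.NumberTheory.EllipticCurves.ModularForms
  Literature.NumberTheory.EllipticCurves.Rank1Residual
  Literature.NumberTheory.EllipticCurves.Rank1Residual.Typed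
  Summit.BirchSwinnertonDyer.Rank1Residual
  Summit.BirchSwinnertonDyer.Rank1Residual.X11b
  Summit.BirchSwinnertonDyer.Rank1Residual.X11b.AcSelmer
  Summit.BirchSwinnertonDyer.Rank1Residual.X11b.LocBridge
  Summit.BirchSwinnertonDyer.BirchSwinnertonDyer.Theorems.SchneiderFree
  Summit.BirchSwinnertonDyer.BirchSwinnertonDyer.Theorems.SchneiderFreeControlAtoms

set_option linter.dupNamespace false

namespace Summit.BirchSwinnertonDyer.BirchSwinnertonDyer.Theorems.SchneiderFreeAdditiveX3

/-! ## §1. The glue in inequality form: no (KER-𝔭) equality, no (P11) -/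

section Glue

variable {W : WeierstrassCurve ℚ} [W.IsElliptic] [W.IsGloballyMinimal] {K : Type} [Field K]
  [NumberField K] {p : ℕ} [Fact p.Prime] {κ : ZpExtension K p}

/-- **T-B6-2 (the control INEQUALITY, slack `0`) from the torsion-robust atoms WITHOUT Fin_v.** For `K`
imaginary quadratic with `p` split and `p ∣ N_E` (additive `p`), an anticyclotomic `κ` with topological
generator `γ`, a prime `𝔭 ∣ p`, any `ι`, `P`, and `g, t, a : ℕ`: IF (KER-res) `#ker res = p^g`, the strict
place's kernel is finite with `#ker r_𝔭 ≤ p^t` (NOT `=`: no Fin_v), (P6-add-tors) `#Sel_𝔭(K, E[p^∞]) = p^a`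
with `a = ord_p #Ш[p^∞] + 2(ord_p log_ω P − ord_p idx) + ord_p ∏_{w∣p} c_w + g − t`, (P9-𝓒) the Poitou–Tate
surjectivity and (L10), THEN `AdditiveControlLeOnTreeAt p κ 𝔭 γ ι 0 P`:
`ord_p f(0) ≤ ord_p #Ш[p^∞] + 2(ord_p log_ω P − ord_p idx) + ord_p ∏_{w∣N⁺} c_w`. The local kernels at
`w ∈ Σ(N⁺)` are bounded by the tree's unconditional Greenberg Lemma 3.3 `#ker r_w ≤ c_w^{(p)}` (no Brink).
Door-c4 gen 0's count `#Sel^γ · #ker res = #Sel_𝔭(K) · #ker r_𝔭 · ∏ #ker r_w` read as an inequality.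
[cite: JetchevSkinnerWan2017, Thm. 3.3.1 and §3.3 (arXiv:1512.06894 pp. 11–14)]
[cite: GreenbergLNM1716, §3 Lemma 3.3 (p. 87) and §4 proof of Thm. 4.1 (p. 74)] -/
theorem additiveControlLeOnTreeAt_of_torsAtomsLe (hK : IsImaginaryQuadratic K) (hsplit : SplitsIn K p)
    (hpN : p ∣ W.conductorNorm ℤ) (hκ : κ.IsAnticyclotomic)
    (γ : absoluteGaloisGroup K) [hγ : Fact (κ.IsTopGenerator γ)] (𝔭 : HeightOneSpectrum (𝓞 K))
    (h𝔭 : ((p : ℕ) : 𝓞 K) ∈ 𝔭.asIdeal) (ι : K →+* ℚ_[p]) (P : (W.baseChange K).toAffine.Point)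
    (g t a : ℕ)
    (hres : Nat.card ((W.baseChange K).resOfLe p (le_top : κ.kerSubgroup ≤ ⊤)).ker = p ^ g)
    (hfin𝔭 : Finite (localKer κ.kerSubgroup ((W.baseChange K).geomPrimaryTorsion p) 𝔭))
    (h𝔭ker : Nat.card (localKer κ.kerSubgroup ((W.baseChange K).geomPrimaryTorsion p) 𝔭) ≤ p ^ t)
    (h6 : (∃ _ : Finite (selmerAcBase (W.baseChange K) p 𝔭 ∅),
        Nat.card (selmerAcBase (W.baseChange K) p 𝔭 ∅) = p ^ a) ∧
      (a : ℤ) = (padicValNat p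
          (Nat.card (AddCommGroup.primaryComponent (W.baseChange K).sha p)) : ℤ) +
        2 * (X11b.padicLogOrd W p ι P - (padicValNat p (AddSubgroup.zmultiples P).index : ℤ)) +
          padicValNat p (X11b.tamagawaProductAbove W K p) + g - t)
    (hloc : ∀ x : Π v : ↥(insert 𝔭 (nPlusPlaces_finite (W := W) (p := p) (K := K) hK.1).toFinset),
        Literature.NumberTheory.EllipticCurves.subgroupH1
          ((⊤ : Subgroup (absoluteGaloisGroup K)) ⊓ decomp (v : HeightOneSpectrum (𝓞 K)))
          ((W.baseChange K).geomPrimaryTorsion p),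
      (∀ v : ↥(insert 𝔭 (nPlusPlaces_finite (W := W) (p := p) (K := K) hK.1).toFinset),
        x v ∈ localKer κ.kerSubgroup ((W.baseChange K).geomPrimaryTorsion p)
          (v : HeightOneSpectrum (𝓞 K))) →
        ∃ c : (W.baseChange K).subgroupH1 p (⊤ : Subgroup (absoluteGaloisGroup K)),
          locAtFinset (W.baseChange K) p _ c = x ∧
          ∀ v : HeightOneSpectrum (𝓞 K), ((p : ℕ) : 𝓞 K) ∉ v.asIdeal → v ∉ (∅ : Set _) →
            v ∉ insert 𝔭 (nPlusPlaces_finite (W := W) (p := p) (K := K) hK.1).toFinset →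
              c ∈ awayKer ⊤ ((W.baseChange K).geomPrimaryTorsion p) v)
    (h10 : X11b.CoinvariantsTrivialAt (W.baseChange K) p κ 𝔭 γ) :
    AdditiveControlLeOnTreeAt p κ 𝔭 γ ι 0 P := by
  have hp : p.Prime := Fact.out
  haveI : IsTotallyComplex K := hK.2
  haveI hEK : (W.baseChange K).IsElliptic := by rw [baseChange]; infer_instance
  obtain ⟨⟨hfinK, hcardK⟩, ha⟩ := h6
  haveI := hfinK
  -- the local kernels at `Σ(N⁺)`: finite, `≤ c_w^{(p)}`, unconditionally
  have h11 : ∀ v ∈ nPlusPlaces W K p,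
      Finite (localKer κ.kerSubgroup ((W.baseChange K).geomPrimaryTorsion p) v) ∧
        Nat.card (localKer κ.kerSubgroup ((W.baseChange K).geomPrimaryTorsion p) v) ≤
          p ^ padicValNat p (((W.baseChange K).baseChange (v.adicCompletion K)).localTamagawaNumber
            (v.adicCompletionIntegers K)) := fun v hv ↦
    natCard_localKer_le_pow_padicValNat_localTamagawaNumber (W.baseChange K) κ
      ((mem_nPlusPlaces_iff v).mp hv).1
  have hfin : ∀ v ∈ nPlusPlaces W K p,
      Finite (localKer κ.kerSubgroup ((W.baseChange K).geomPrimaryTorsion p) v) :=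
    fun v hv ↦ (h11 v hv).1
  obtain ⟨hfinγ, _, hcount⟩ := natCard_endInvariants_mul_natCard_resKer_eq_nPlus (W := W) hK hκ γ 𝔭
    h𝔭 hfin𝔭 hfin hloc
  haveI := hfinγ
  -- the product of the local kernels at `Σ(N⁺)` is at most `p^{Σ ord_p c_w}`
  have hprod : (∏ v ∈ (nPlusPlaces_finite (W := W) (p := p) (K := K) hK.1).toFinset,
      Nat.card (localKer κ.kerSubgroup ((W.baseChange K).geomPrimaryTorsion p) v)) ≤
        p ^ ∑ v ∈ (nPlusPlaces_finite (W := W) (p := p) (K := K) hK.1).toFinset, padicValNat p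
          (((W.baseChange K).baseChange (v.adicCompletion K)).localTamagawaNumber
            (v.adicCompletionIntegers K)) := by
    rw [← Finset.prod_pow_eq_pow_sum]
    refine Finset.prod_le_prod (fun _ _ ↦ Nat.zero_le _) fun v hv ↦ ?_
    exact (h11 v ((nPlusPlaces_finite (W := W) (p := p) hK.1).mem_toFinset.mp hv)).2
  -- `#Sel^γ = p^n`
  obtain ⟨n, hn⟩ := AcSelmer.exists_natCard_endInvariants_eq_pow (W.baseChange K) p κ 𝔭 ∅ γ
  set σ : ℕ := ∑ v ∈ (nPlusPlaces_finite (W := W) (p := p) (K := K) hK.1).toFinset, padicValNat p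
    (((W.baseChange K).baseChange (v.adicCompletion K)).localTamagawaNumber
      (v.adicCompletionIntegers K)) with hσ
  -- `p^n · p^g = p^a · #ker r_𝔭 · ∏ #ker r_w ≤ p^a · p^t · p^σ`
  have hle : p ^ (n + g) ≤ p ^ (a + t + σ) := by
    rw [pow_add, ← hn, ← hres, hcount, hcardK, pow_add, pow_add, mul_assoc]
    exact Nat.mul_le_mul_left _ (Nat.mul_le_mul h𝔭ker hprod)
  have hle' : n + g ≤ a + t + σ := (Nat.pow_le_pow_iff_right hp.one_lt).mp hle
  have hcoinv := X11b.natCard_endCoinvariants_eq_one_of_surjective _ h10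
  haveI := X11b.module_finite_XAc_baseChange p κ 𝔭 γ (W := W)
  refine ⟨n, ?_, ?_⟩
  · rw [XAc.hasCharValuationAt_iff_card]
    exact ⟨hfinγ, by rw [hn, hcoinv, mul_one]⟩
  · rw [X11b.padicValNat_tamagawaProductSplit_eq_above_add_sum W p hK.1 hsplit hpN, ← hσ]
    have hZ : (n : ℤ) + g ≤ a + t + σ := by exact_mod_cast hle'
    rw [ha] at hZ
    simp only [Nat.cast_add, Nat.cast_zero, mul_zero, add_zero]
    linarith

end Glue

/-! ## §2. The control INEQUALITY at every frame of the door, from three cited facts (no Brink, no Fin_v) -/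

section Facts

open Summit.BirchSwinnertonDyer.BirchSwinnertonDyer.Theses.SchneiderFreeAdditiveX3

/-- **T-B6-2 (`AdditiveControlLeOnTreeAt … 0`) at EVERY frame of the door — any `g`, any `t_p`, cells (M)
and (G-ord, `e = 2`) alike — from Poitou–Tate duality, the duality for `Ш`, and Kolyvagin.** For `E/ℚ`
globally minimal, `p` odd additive (N10 locus), `K` imaginary quadratic Heegner field (so `p` splits) with
`p ∤ #μ(K)`, `κ` anticyclotomic with topological generator `γ`, a degree-one `𝔭 ∋ p`, `rank E(K) = 1` and
`Ш(E/K)` finite (Kolyvagin at the non-torsion Heegner point `P`): the count of §1 with `p^g = #ker res =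
#E(K)[p^∞]` (door-c4 gen 0 + door-c5 gen 4 + Galois descent), `#ker r_𝔭 ≤ #E(ℚ_p)[p^∞] = p^{t_p}`
(X11b, unconditional), (P6-add-tors) at any `g` (door-c4 gen 3 / door-c6 gen 2), (P9-𝓒) and (L10)
(door-c6). NO Fin_v, NO Brink. CONDITIONAL (hypotheses BY NAME); BSD is not proved by any of this.
[cite: JetchevSkinnerWan2017, Thm. 3.3.1 (arXiv:1512.06894 p. 11)]
[cite: KellerYin2024, App. B Thm. B.0.6 (arXiv:2402.12781 pp. 29–30)]
[cite: MilneADT2006, Ch. I, Thm. 4.10 and Thm. 2.8] [cite: Kolyvagin1990, Thm. A] -/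
theorem additiveControlLeOnTreeAt_of_facts
    (hPT : ∀ (K : Type) [Field K] [NumberField K], poitouTate_selmerStructure_duality K)
    (hPT2 : ∀ (K : Type) [Field K] [NumberField K], poitouTate_sha_tateDual K)
    (hKo : ∀ (N : ℕ) [NeZero N] (W : WeierstrassCurve ℚ) (K : Type) [Field K] [NumberField K],
      Literature.NumberTheory.EllipticCurves.kolyvagin N W K) :
    ∀ (W : WeierstrassCurve ℚ) [W.IsElliptic] [W.IsGloballyMinimal] (p : ℕ) [Fact p.Prime],
      W.analyticRank = 1 → p ≠ 2 → ClassX3 W p → Additive.SubSemistableTwist W p →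
      ∀ (N : ℕ) [NeZero N] (K : Type) [Field K] [NumberField K]
        (Dt : ModularParametrizationData W N) (H : HeegnerDatum N (NumberField.discr K)) (ι : K →+* ℂ)
        (P : (W.baseChange K).toAffine.Point),
        W.analyticRank = 1 → Additive.N10.Locus W p → W.conductorNorm ℤ = N →
        ∀ hK : IsImaginaryQuadratic K,
        Odd (NumberField.discr K) → ¬ p ∣ Units.torsionOrder K → SatisfiesHeegnerHypothesis N K →
        (W.quadraticTwist (NumberField.discr K : ℚ)).entireLFunction 1 ≠ 0 →
        WeierstrassCurve.Affine.Point.map ι.toRatAlgHom P = heegnerPointComplex Dt H →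
        ¬ IsOfFinAddOrder P →
        ∀ (κ : ZpExtension K p), κ.IsAnticyclotomic →
          ∀ (γ : Field.absoluteGaloisGroup K) [Fact (κ.IsTopGenerator γ)]
            (𝔭 : HeightOneSpectrum (𝓞 K)) (h𝔭 : ((p : ℕ) : 𝓞 K) ∈ 𝔭.asIdeal)
            (he : 𝔭.asIdeal.ramificationIdx (𝓞 ℚ) = 1) (hf : 𝔭.asIdeal.inertiaDeg (𝓞 ℚ) = 1),
            AdditiveControlLeOnTreeAt p κ 𝔭 γ (embAt K p 𝔭 h𝔭 he hf) 0 P := by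
  intro W _ _ p _ hr hp2 hX hS N _ K _ _ Dt H ι P hr' hloc hN hK hodd hunit hHe hL1 hP hnt κ hκ γ _ 𝔭
    h𝔭 he hf
  have hp : p.Prime := Fact.out
  haveI : IsTotallyComplex K := hK.2
  haveI hEK : (W.baseChange K).IsElliptic := by rw [baseChange]; infer_instance
  have hpN : p ∣ W.conductorNorm ℤ := dvd_conductorNorm_of_n10Locus hloc
  have hsplit : SplitsIn K p := splitsIn_of_satisfiesHeegnerHypothesis hN hHe hpN
  obtain ⟨hrank, hSha⟩ := hKo N W K hK hHe ⟨Dt, H, ι, hP⟩ hnt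
  -- `p^g = #E(K)[p^∞] = #E_K[p^∞]^{Γ_K} = #ker res`
  set g := padicValNat p (Nat.card (AddCommGroup.primaryComponent (W.baseChange K).toAffine.Point p))
    with hgdef
  have hcardg := natCard_primaryComponent_point_eq_pow (W.baseChange K) p
  haveI := finite_fixedPoints_kerSubgroup_of_not_dvd_torsionOrder W p κ hp2 hK hunit hκ
  have hres : Nat.card ((W.baseChange K).resOfLe p (le_top : κ.kerSubgroup ≤ ⊤)).ker = p ^ g := by
    rw [natCard_ker_resOfLe_top_eq_natCard_fixedPoints (W.baseChange K) p κ,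
      natCard_fixedPoints_geomPrimaryTorsion_eq_natCard_primaryComponent (W.baseChange K) p, hcardg]
  -- `#ker r_𝔭 ≤ #E(ℚ_p)[p^∞] = p^{t_p}`, unconditionally
  obtain ⟨tp, htp⟩ := exists_natCard_primaryComponent_padic_eq_pow W p
  obtain ⟨hfin𝔭, hle𝔭⟩ := natCard_localKer_le_natCard_primaryComponent_padic W p κ 𝔭 h𝔭 he hf
  rw [htp] at hle𝔭
  -- (P6-add-tors) at any `g`
  obtain ⟨hfinS, a, hcard, ha⟩ := additiveBaseSelmerCountTors_of_rankOne_anyTorsion W p K (hPT K)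
    (fun v ↦ localEulerPoincareCharacteristic_adicCompletionEP K v) hloc.2.1 hK hsplit hrank hSha P hnt
    𝔭 h𝔭 he hf
  have hcard' : Nat.card (selmerAcBase (W.baseChange K) p 𝔭 ∅) * p ^ tp = p ^ a := by
    rw [← htp]; exact hcard
  have hle : tp ≤ a :=
    (Nat.pow_dvd_pow_iff_le_right hp.one_lt).mp ⟨_, by rw [mul_comm]; exact hcard'.symm⟩
  have hcardSel : Nat.card (selmerAcBase (W.baseChange K) p 𝔭 ∅) = p ^ (a - tp) := by
    have hsplitpow : p ^ a = p ^ (a - tp) * p ^ tp := by rw [← pow_add, Nat.sub_add_cancel hle]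
    rw [hsplitpow] at hcard'
    exact Nat.eq_of_mul_eq_mul_right (pow_pos hp.pos tp) hcard'
  refine additiveControlLeOnTreeAt_of_torsAtomsLe (W := W) hK hsplit hpN hκ γ 𝔭 h𝔭
    (embAt K p 𝔭 h𝔭 he hf) P g tp (a - tp) hres hfin𝔭 hle𝔭 ⟨⟨hfinS, hcardSel⟩, ?_⟩
    (stub_ptSurj_of_poitouTate hPT hKo W p hr hp2 hX hS N K Dt H ι P hr' hloc hN hK hodd hunit hHe hL1
      hP hnt κ hκ γ 𝔭 h𝔭 he hf)
    (stub_coinv_of_poitouTate hPT hPT2 hKo W p hr hp2 hX hS N K Dt H ι P hr' hloc hN hK hodd hunit hHe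
      hL1 hP hnt κ hκ γ 𝔭 h𝔭 he hf)
  rw [Nat.cast_sub hle, ha]

end Facts

/-! ## §3. The link with `≤`: the route's TARGET `StepLManin` from three facts and the two branch cruxes -/

section Link

open Summit.BirchSwinnertonDyer.BirchSwinnertonDyer.Theses.SchneiderFreeAdditiveX3

variable {W : WeierstrassCurve ℚ} [W.IsElliptic] [W.IsGloballyMinimal] {K : Type} [Field K]
  [NumberField K] {p : ℕ} [Fact p.Prime] {κ : ZpExtension K p} {𝔭 : HeightOneSpectrum (𝓞 K)}
  {γ : Field.absoluteGaloisGroup K} [Fact (κ.IsTopGenerator γ)] {ι : K →+* ℚ_[p]}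

/-- **Bookkeeping with a Manin slack, INEQUALITY form of control (kernel-checked):** slack-`s` T-B6-1 and the
slack-`0` control inequality T-B6-2 at one frame give
`2·ord_p[E(K):ℤP] ≤ ord_p #Ш(E/K)[p^∞] + ord_p ∏_{w∣N⁺} c_w(E/K) + 2s` — exactly what
`SchneiderFree.index_le_slack_of_additive_links` extracts from the EQUALITY. [folklore] -/
theorem index_le_slack_of_additive_linksLe {P : (W.baseChange K).toAffine.Point} {s : ℕ}
    (h1 : AdditiveIMCLowerBDPOnTreeLeAt p κ 𝔭 γ ι s P) (h2 : AdditiveControlLeOnTreeAt p κ 𝔭 γ ι 0 P) :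
    2 * (padicValNat p (AddSubgroup.zmultiples P).index : ℤ) ≤
      (padicValNat p (Nat.card (AddCommGroup.primaryComponent (W.baseChange K).sha p)) : ℤ) +
        padicValNat p (X11b.tamagawaProductSplit W K) + 2 * (s : ℤ) := by
  obtain ⟨n, hn, hle⟩ := h1
  obtain ⟨n', hn', hle'⟩ := h2
  obtain rfl : n = n' := hn.unique hn'
  simp only [Nat.cast_zero, mul_zero, add_zero] at hle'
  omega

omit [Fact (κ.IsTopGenerator γ)] in
/-- **From the frame statements to STEP L over `K`, at one Heegner datum, given `Ш(E/K)` finite — with the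
control INEQUALITY.** Door-c2's `indexLowerBoundLeAt_of_frames_of_shaFinite` with its hypothesis `h2`
weakened from `AdditiveControlOnTreeAt` to `AdditiveControlLeOnTreeAt … 0`: a frame `(κ, γ, 𝔭)` with `𝔭 ∣ p`
of degree one exists, the slack-`s` link T-B6-1 and the control inequality at that frame give
`IndexLowerBoundLeAt W p K P s` by `index_le_slack_of_additive_linksLe`, the Tamagawa transport for every `p`,
and `ord_p #Ш(E/K)[p^∞] = ord_p #Ш(E/K)` for finite `Ш`. [cite: JetchevSkinnerWan2017, §7.4.1 (arXiv p. 30)] -/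
theorem indexLowerBoundLeAt_of_frames_of_shaFinite_le {N : ℕ} {P : (W.baseChange K).toAffine.Point}
    {s : ℕ} (hloc : Additive.N10.Locus W p) (hN : W.conductorNorm ℤ = N) (hK : IsImaginaryQuadratic K)
    (hHe : SatisfiesHeegnerHypothesis N K) (hfin : (W.baseChange K).ShaFinite)
    (h1 : ∀ (κ : ZpExtension K p), κ.IsAnticyclotomic →
      ∀ (γ : Field.absoluteGaloisGroup K) [Fact (κ.IsTopGenerator γ)]
        (𝔭 : HeightOneSpectrum (𝓞 K)) (h𝔭 : ((p : ℕ) : 𝓞 K) ∈ 𝔭.asIdeal)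
        (he : 𝔭.asIdeal.ramificationIdx (𝓞 ℚ) = 1) (hf : 𝔭.asIdeal.inertiaDeg (𝓞 ℚ) = 1),
        AdditiveIMCLowerBDPOnTreeLeAt p κ 𝔭 γ (embAt K p 𝔭 h𝔭 he hf) s P)
    (h2 : ∀ (κ : ZpExtension K p), κ.IsAnticyclotomic →
      ∀ (γ : Field.absoluteGaloisGroup K) [Fact (κ.IsTopGenerator γ)]
        (𝔭 : HeightOneSpectrum (𝓞 K)) (h𝔭 : ((p : ℕ) : 𝓞 K) ∈ 𝔭.asIdeal)
        (he : 𝔭.asIdeal.ramificationIdx (𝓞 ℚ) = 1) (hf : 𝔭.asIdeal.inertiaDeg (𝓞 ℚ) = 1),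
        AdditiveControlLeOnTreeAt p κ 𝔭 γ (embAt K p 𝔭 h𝔭 he hf) 0 P) :
    IndexLowerBoundLeAt W p K P s := by
  have hp : p.Prime := Fact.out
  -- `p` is additive, so `p ∣ N_E`, so `p` splits in the Heegner field `K`
  have hpN : p ∣ W.conductorNorm ℤ :=
    (W.dvd_conductorNorm_iff_not_hasGoodReductionAtPrime p).mpr (not_good_of_addv W p hloc.2.1)
  have hsplit : SplitsIn K p := hHe p hp (hN ▸ hpN)
  -- a frame: anticyclotomic `κ`, topological generator `γ`, degree-one `𝔭 ∣ p`
  obtain ⟨κ, γ, -, hκ, hγ, -⟩ := X11b.exists_anticyclotomic_generator_prime (p := p) hK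
  haveI : Fact (κ.IsTopGenerator γ) := ⟨hγ⟩
  obtain ⟨𝔭, h𝔭, he, hf⟩ := X11b.exists_degreeOnePrime_of_splitsIn K p hK.1 hsplit
  -- the bookkeeping at that frame
  have hineq := index_le_slack_of_additive_linksLe (h1 κ hκ γ 𝔭 h𝔭 he hf) (h2 κ hκ γ 𝔭 h𝔭 he hf)
  -- Tamagawa transport (every `p`) and `Ш[p^∞]` vs `Ш` for finite `Ш`
  have htam1 := X11b.padicValNat_tamagawaProductSplit_eq_of_heegner_prime W K p hN hHe
  have htam2 := X11b.padicValNat_tamagawaProduct_baseChange_of_heegner_prime W K p hK hN hHe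
  haveI : Finite (W.baseChange K).sha := hfin
  have hsha : padicValNat p (Nat.card (AddCommGroup.primaryComponent (W.baseChange K).sha p)) =
      padicValNat p (W.baseChange K).shaOrder := by
    rw [Literature.NumberTheory.EllipticCurves.natCard_primaryComponent_eq_pow_padicValNat p,
      padicValNat.prime_pow]
    rfl
  unfold IndexLowerBoundLeAt
  rw [htam1, htam2, hsha] at hineq
  omega

/-- **The route's TARGET `StepLManin` from three cited facts and the two branch main conjectures — NO control
crux, NO Fin_v.** Poitou–Tate duality, the duality for `Ш`, Kolyvagin's finiteness (the `kolyvagin` conjunct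
of `PrintedFacts`), `PotMultBranchIMC` (crux r2, cell (M)) and `GordTwoBranchIMC` (crux r3, cell
(G-ord, `e = 2`)) give `StepLManin` BY NAME: §2 supplies the control inequality at every frame.
[cite: JetchevSkinnerWan2017, §7.4.1 (arXiv p. 30)] [cite: Gross1991, Thm. 1.3] -/
theorem stepLManin_of_facts_of_branchIMCs
    (hPT : ∀ (K : Type) [Field K] [NumberField K], poitouTate_selmerStructure_duality K)
    (hPT2 : ∀ (K : Type) [Field K] [NumberField K], poitouTate_sha_tateDual K)
    (hKo : ∀ (N : ℕ) [NeZero N] (W : WeierstrassCurve ℚ) (K : Type) [Field K] [NumberField K],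
      Literature.NumberTheory.EllipticCurves.kolyvagin N W K)
    (h2 : PotMultBranchIMC) (h3 : GordTwoBranchIMC) : StepLManin := by
  intro W _ _ p _ hr hp2 hX hS N _ K _ _ Dt H ι P hr' hloc hN hK hodd hunit hHe hL hP hnt
  have hfin : (W.baseChange K).ShaFinite := (hKo N W K hK hHe ⟨Dt, H, ι, hP⟩ hnt).2
  refine indexLowerBoundLeAt_of_frames_of_shaFinite_le hloc hN hK hHe hfin ?_ ?_
  · intro κ hκ γ _ 𝔭 h𝔭 he hf
    rcases hS with hM | hG
    · exact h2 W p hr hp2 hX hM N K Dt H ι P hr' hloc hN hK hodd hunit hHe hL hP hnt κ hκ γ 𝔭 h𝔭 he hf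
    · exact h3 W p hr hp2 hX hG N K Dt H ι P hr' hloc hN hK hodd hunit hHe hL hP hnt κ hκ γ 𝔭 h𝔭 he hf
  · intro κ hκ γ _ 𝔭 h𝔭 he hf
    exact additiveControlLeOnTreeAt_of_facts hPT hPT2 hKo W p hr hp2 hX hS N K Dt H ι P hr' hloc hN hK
      hodd hunit hHe hL hP hnt κ hκ γ 𝔭 h𝔭 he hf

end Link

/-! ## §4. The rung leaf from `PrintedFacts`, `ControlFacts` and the two branch cruxes -/

section Leaf

open Summit.BirchSwinnertonDyer.BirchSwinnertonDyer.Theses.SchneiderFreeAdditiveX3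

/-- **The rung leaf `AdditiveX3RankOneLower` from `PrintedFacts`, the two Poitou–Tate facts, and the branch
main conjectures r2/r3 — the route's deciding theorem `closes` re-run WITHOUT its control hypothesis
`h4 : AnticycControlAdditiveKF` (crux r4) and without `StepLManinLinkR`; the closed support items
`HeegnerTwistData`, `JointLowerManin`, `PartnerUpperRankZero` are discharged by their tree proofs.**  The lower
half of BSD_p on B6 ∩ X3 ∩ sst-twist, `r_an = 1`, `p` odd, CONDITIONAL on the cited facts that are antecedents
of the statement and on the two analytic cruxes; BSD is not advanced beyond this typed reduction.
[cite: JetchevSkinnerWan2017, §7.4.1 (eq:shalowerK-1) (arXiv:1512.06894 p. 30)]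
[cite: MilneADT2006, Ch. I, Thm. 4.10 and Thm. 2.8] [cite: Kolyvagin1990, Thm. A] -/
theorem additiveX3RankOneLower_of_facts_of_branchIMCs (hF : PrintedFacts)
    (hPT : ∀ (K : Type) [Field K] [NumberField K], poitouTate_selmerStructure_duality K)
    (hPT2 : ∀ (K : Type) [Field K] [NumberField K], poitouTate_sha_tateDual K)
    (h2 : PotMultBranchIMC) (h3 : GordTwoBranchIMC) :
    Summit.BirchSwinnertonDyer.BirchSwinnertonDyer.Theorems.SchneiderFree.AdditiveX3RankOneLower := by
  have hK : HeegnerTwistData := schneiderFreeAdditiveX3_heegnerTwistData_proof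
  have hJ : JointLowerManin := schneiderFreeAdditiveX3_jointLowerManin_proof
  have hU : PartnerUpperRankZero := schneiderFreeAdditiveX3_partnerUpperRankZero_proof
  obtain ⟨hGZ, hKo, hGZK, hmod, hmodD, hCas, hGZ73, hFH, hpar, hHP, hDel, hW16, hWu⟩ := hF
  have hstepL : StepLManin := stepLManin_of_facts_of_branchIMCs hPT hPT2 hKo h2 h3
  intro W _ _ p _ hr hp2 hX hS
  have hstep : AdditiveStepLInputManinAt W p := hstepL W p hr hp2 hX hS
  have hdata : HeegnerTwistDataManinAt W p := hK hFH hpar hHP hGZ hmod hmodD W p hr hp2 hX hS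
  obtain ⟨N, _, K, _, _, Dt, H, ι, P, Wd, _, _, hN, hKiq, hodd, hunit, hHe, hLtw, hP, hnt, hWd,
    hrd, hXd, hSd⟩ := hdata
  have hloc : Additive.N10.Locus W p :=
    (Additive.N10.locus_iff_cells W p).mpr
      ((Additive.N10.cellM_or_cellGordTwo_of_classX3_of_subSemistableTwist W p hp2 hX hS).elim Or.inl
        (fun h ↦ Or.inr (Or.inl h)))
  have hidx : IndexLowerBoundLeAt W p K P (padicValNat p Dt.c.natAbs) :=
    hstep N K Dt H ι P hr hloc hN hKiq hodd hunit hHe hLtw hP hnt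
  have hJ' : JointLowerBoundAt W Wd p :=
    hJ hGZ hKo hGZK hmod hmodD hCas hGZ73 W p N K Dt H ι P Wd hr hN hKiq hodd hunit hHe hLtw hP hnt hWd
      hrd hp2 hidx
  exact missingLowerBoundAt_of_joint_of_upper hJ' (hU hDel hGZK hmod hmodD hW16 hWu Wd p hrd hp2 hXd hSd)

/-- **The rung leaf from the route's two fact binders and the two branch cruxes:
`PrintedFacts → ControlFacts → PotMultBranchIMC → GordTwoBranchIMC → AdditiveX3RankOneLower`.** The route's
`closes` with `h4` (control, crux r4) and `hL` (the link) and the three closed support items REMOVED; of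
`ControlFacts` only the two Poitou–Tate conjuncts are used (Brink's Thm. 2 / Cor. 1 are not). CONDITIONAL
on the cited facts inside the two binders; closes no item by name; BSD is not advanced beyond this.
[cite: JetchevSkinnerWan2017, §7.4.1 (arXiv:1512.06894 p. 30)] [cite: MilneADT2006, Ch. I, Thm. 4.10 and Thm. 2.8] -/
theorem additiveX3RankOneLower_of_printedFacts_of_controlFacts_of_branchIMCs (hF : PrintedFacts)
    (hCF : ControlFacts) (h2 : PotMultBranchIMC) (h3 : GordTwoBranchIMC) :
    Summit.BirchSwinnertonDyer.BirchSwinnertonDyer.Theorems.SchneiderFree.AdditiveX3RankOneLower :=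
  additiveX3RankOneLower_of_facts_of_branchIMCs hF hCF.1 hCF.2.1 h2 h3

end Leaf

end Summit.BirchSwinnertonDyer.BirchSwinnertonDyer.Theorems.SchneiderFreeAdditiveX3

end
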